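import Summits.HodgeConjecture.HodgeConjecture.Theorems.LinearSystemTorelliTranscendentalOrSupportedStubOfMiddleOfHodgeEffective
import Summits.HodgeConjecture.HodgeConjecture.Theorems.LinearSystemTorelliTranscendentalOrSupportedStubHodgeEffectiveOfAbstract
import Summits.HodgeConjecture.HodgeConjecture.Theorems.LinearSystemTorelliSupportedOfTranscendentalOrSupported
import Literature.AlgebraicGeometry.HodgeTheory.SaitoGrFDeRhamCurveNetHolds

/-!
# Crux `TranscendentalOrSupported` (stmt-HodgeConjecture-10853), line `HodgeEffectivity` v4:
# the crux from `MiddleDivisorSupport` (item 1081) and Hodge effectivity in Hodge-STRUCTURE form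

Route `LinearSystemTorelli`, crux `TranscendentalOrSupported` = GHC(2p, coniveau 1) in Grothendieck's
sub-Hodge form. This file lands the registered ABSTRACT assembly stub of skeleton v4,

* `stub_transcendentalOrSupported_of_middle_of_hodgeEffectiveAbstract :
    MiddleDivisorSupport → HodgeEffectiveAbstract → TranscendentalOrSupported`,

where `HodgeEffectiveAbstract` (written out; the registered bet `stub_hodgeEffectiveAbstract`) is
Voisin's Conjecture 4.7 (J. Open Math. Probl. 1 (2025) §4.2) for the coniveau-1 phantom constituents
`W` of `H²ᵖ(X^{2p})` IN ITS OWN, HODGE-STRUCTURE TERMS: `W` lies in the sum of the images of the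
rational Hodge-structure morphisms `φ : Hᵃ(Y(ℂ); ℂ) → H²ᵖ(X(ℂ); ℂ)` of bidegree `(r, r)`, `r ≥ 1`,
from the cohomology of smooth projective varieties `Y` ("the Tate twist of `W` is effective"). It is
two lines from the landed pieces: the bridge `stub_hodgeEffective_of_abstract` (abstract ⟹
correspondence form; Voisin I Lemma 11.41 on the tree's carriers, p138029) and the composition
`stub_transcendentalOrSupported_of_middle_of_hodgeEffective` (Voisin's Prop. 4.8 on the carriers: the
Hodge conjecture — from `MiddleDivisorSupport` alone, `hodgeConjecture_of_middleDivisorSupport` —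
makes every rational Hodge class on `X ⊗ Y` algebraic, hence its action lands in `N¹`; p138214).

With the converse `hodgeEffectiveAbstract_of_transcendentalOrSupported` (crux ⟹
`HodgeEffectiveAbstract`; Deligne's Cor. 8.2.8 is now the tree's THEOREM
`Deligne1974_ker_restrictCompl_eq_iSup_range_complexGysin_holds`, so NO hypothesis is left), the closed
glue 2411 (`linearSystemTorelli_supportedOfTranscendentalOrSupported_proof` : crux ⟹ item 1081) and
`hodgeConjecture_of_middleDivisorSupport` (item 1081 ⟹ HC, p138214), this file certifies
UNCONDITIONALLY, kernel-checked:

* `middleDivisorSupport_iff_hodgeConjecture` : item 1081 ↔ `HodgeConjecture` (Thomas 2005 Thm. 1 in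
  the tree's divisor-support form);
* `transcendentalOrSupported_iff_middle_and_hodgeEffectiveAbstract` :
  crux ↔ `MiddleDivisorSupport` ∧ `HodgeEffectiveAbstract`;
* `transcendentalOrSupported_iff_hodgeConjecture_and_hodgeEffectiveAbstract` :
  crux ↔ `HodgeConjecture` ∧ `HodgeEffectiveAbstract` — GHC(2p, coniveau 1) for the middle cohomology
  IS the Hodge conjecture plus Voisin's effectivity Conjecture 4.7(2p, 1), nothing more and nothing
  less ("The Hodge conjecture itself does not imply the generalized Hodge conjecture", Voisin 2025
  §4.2, made exact).

The first theorem is the glue (`--glue-by`) of the split {item stmt-HodgeConjecture-1081,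
`HodgeEffectiveAbstract`} of the crux, whose second child needs no import beyond the route file's.

References: C. Voisin, J. Open Math. Probl. 1 (2025) 16–51, Lemma 2.9, Conj. 4.7, Prop. 4.8;
C. Voisin, Hodge Theory and Complex Algebraic Geometry I (2002), §11.3.3 Lemma 11.41; R. Thomas,
J. Algebraic Geom. 14 (2005), Thm. 1; P. Deligne, Théorie de Hodge III (1974), Cor. 8.2.8.
-/

noncomputable section

set_option linter.dupNamespace false

open CategoryTheory MonoidalCategory CartesianMonoidalCategory
open Literature.AlgebraicGeometry.Motives Literature.AlgebraicGeometry.HodgeTheory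
open Literature.AlgebraicTopology.SingularHomology

namespace Summit.HodgeConjecture.HodgeConjecture.Theorems

/-! ### Abstract form: the crux from `MiddleDivisorSupport` and Hodge effectivity in Hodge-structure terms -/

/-- **Stub `stub_transcendentalOrSupported_of_middle_of_hodgeEffectiveAbstract` of line
`HodgeEffectivity` (registered abstract assembly, skeleton v4) — the crux from `MiddleDivisorSupport`
(item 1081) and Hodge effectivity in its ABSTRACT, Hodge-structure form** (`HodgeEffectiveAbstract` =
registered stub `stub_hodgeEffectiveAbstract`, written out: every irreducible rationally spanned sub-Hodge structure
`W ⊆ H²ᵖ(X(ℂ); ℂ)` of rank `≥ 2` without `(2p,0)`-part lies in the sum of the images of the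
rational Hodge-structure morphisms `φ : Hᵃ(Y(ℂ)) → H²ᵖ(X(ℂ))` of bidegree `(r, r)`, `r ≥ 1`, from
smooth projective `Y` — Voisin's Conj. 4.7 for `(k, c) = (2p, 1)` restricted to these `W`): the
bridge `stub_hodgeEffective_of_abstract` (Voisin I Lemma 11.41 on the carriers) followed by
`stub_transcendentalOrSupported_of_middle_of_hodgeEffective`. This is the glue of the split
{`MiddleDivisorSupport`, `HodgeEffectiveAbstract`} of the crux; `transcendentalOrSupported_of_middle_of_hodgeEffectiveAbstract`
is the same under its descriptive name.
[cite: Voisin2025, Conj. 4.7 and Prop. 4.8] [cite: VoisinHodgeI2002, §11.3.3 Lemma 11.41] -/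
theorem stub_transcendentalOrSupported_of_middle_of_hodgeEffectiveAbstract
    (hMid : Summit.HodgeConjecture.HodgeConjecture.Theses.LinearSystemTorelli.MiddleDivisorSupport)
    (hAbs : ∀ ⦃p : ℕ⦄ ⦃X : SchemeOver ℂ⦄, 1 ≤ p → ∀ (hX : IsSmoothProjective (2 * p) X)
      (A : HodgeModel (2 * p) X) (r : ℕ) (b : Fin r → complexBetti X (2 * p)),
      (∀ j, IsRationalClass (b j)) →
      (Submodule.span ℂ (Set.range b)).map (A.pullback (2 * p)).hom =
        ⨆ (p' : ℕ) (q' : ℕ) (_ : p' + q' = 2 * p),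
          (Submodule.span ℂ (Set.range b)).map (A.pullback (2 * p)).hom ⊓ A.hodgePQ (2 * p) p' q' →
      (Submodule.span ℂ (Set.range b)).map (A.pullback (2 * p)).hom ⊓ A.hodgePQ (2 * p) (2 * p) 0 = ⊥ →
      (∀ V : Submodule ℂ (complexBetti X (2 * p)), V ≤ Submodule.span ℂ (Set.range b) →
        Submodule.span ℂ {x : complexBetti X (2 * p) | x ∈ V ∧ IsRationalClass x} = V →
        V.map (A.pullback (2 * p)).hom =
          ⨆ (p' : ℕ) (q' : ℕ) (_ : p' + q' = 2 * p),
            V.map (A.pullback (2 * p)).hom ⊓ A.hodgePQ (2 * p) p' q' →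
        V = ⊥ ∨ V = Submodule.span ℂ (Set.range b)) →
      2 ≤ Module.finrank ℂ (Submodule.span ℂ (Set.range b)) →
      Submodule.span ℂ (Set.range b) ≤
        ⨆ (m : ℕ) (Y : SchemeOver ℂ) (_ : IsSmoothProjective m Y) (B : HodgeModel m Y)
          (a : ℕ) (r : ℕ) (_ : a + 2 * r = 2 * p) (_ : 1 ≤ r)
          (φ : complexBetti Y a →ₗ[ℂ] complexBetti X (2 * p))
          (_ : ∀ c, IsRationalClass c → IsRationalClass (φ c))
          (_ : ∀ (p' q' : ℕ), p' + q' = a → ∀ c, B.pullback a c ∈ B.hodgePQ a p' q' →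
            A.pullback (2 * p) (φ c) ∈ A.hodgePQ (2 * p) (p' + r) (q' + r)),
          LinearMap.range φ) :
    Summit.HodgeConjecture.HodgeConjecture.Theses.LinearSystemTorelli.TranscendentalOrSupported :=
  stub_transcendentalOrSupported_of_middle_of_hodgeEffective hMid (stub_hodgeEffective_of_abstract hAbs)

/-- **The crux from `MiddleDivisorSupport` and `HodgeEffectiveAbstract`** — descriptive alias of the
registered stub `stub_transcendentalOrSupported_of_middle_of_hodgeEffectiveAbstract` (the `--glue-by`
theorem of the split {item 1081, `HodgeEffectiveAbstract`}). [cite: Voisin2025, Conj. 4.7 and Prop. 4.8] -/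
theorem transcendentalOrSupported_of_middle_of_hodgeEffectiveAbstract
    (hMid : Summit.HodgeConjecture.HodgeConjecture.Theses.LinearSystemTorelli.MiddleDivisorSupport)
    (hAbs : ∀ ⦃p : ℕ⦄ ⦃X : SchemeOver ℂ⦄, 1 ≤ p → ∀ (hX : IsSmoothProjective (2 * p) X)
      (A : HodgeModel (2 * p) X) (r : ℕ) (b : Fin r → complexBetti X (2 * p)),
      (∀ j, IsRationalClass (b j)) →
      (Submodule.span ℂ (Set.range b)).map (A.pullback (2 * p)).hom =
        ⨆ (p' : ℕ) (q' : ℕ) (_ : p' + q' = 2 * p),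
          (Submodule.span ℂ (Set.range b)).map (A.pullback (2 * p)).hom ⊓ A.hodgePQ (2 * p) p' q' →
      (Submodule.span ℂ (Set.range b)).map (A.pullback (2 * p)).hom ⊓ A.hodgePQ (2 * p) (2 * p) 0 = ⊥ →
      (∀ V : Submodule ℂ (complexBetti X (2 * p)), V ≤ Submodule.span ℂ (Set.range b) →
        Submodule.span ℂ {x : complexBetti X (2 * p) | x ∈ V ∧ IsRationalClass x} = V →
        V.map (A.pullback (2 * p)).hom =
          ⨆ (p' : ℕ) (q' : ℕ) (_ : p' + q' = 2 * p),
            V.map (A.pullback (2 * p)).hom ⊓ A.hodgePQ (2 * p) p' q' →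
        V = ⊥ ∨ V = Submodule.span ℂ (Set.range b)) →
      2 ≤ Module.finrank ℂ (Submodule.span ℂ (Set.range b)) →
      Submodule.span ℂ (Set.range b) ≤
        ⨆ (m : ℕ) (Y : SchemeOver ℂ) (_ : IsSmoothProjective m Y) (B : HodgeModel m Y)
          (a : ℕ) (r : ℕ) (_ : a + 2 * r = 2 * p) (_ : 1 ≤ r)
          (φ : complexBetti Y a →ₗ[ℂ] complexBetti X (2 * p))
          (_ : ∀ c, IsRationalClass c → IsRationalClass (φ c))
          (_ : ∀ (p' q' : ℕ), p' + q' = a → ∀ c, B.pullback a c ∈ B.hodgePQ a p' q' →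
            A.pullback (2 * p) (φ c) ∈ A.hodgePQ (2 * p) (p' + r) (q' + r)),
          LinearMap.range φ) :
    Summit.HodgeConjecture.HodgeConjecture.Theses.LinearSystemTorelli.TranscendentalOrSupported :=
  stub_transcendentalOrSupported_of_middle_of_hodgeEffectiveAbstract hMid hAbs

/-- **TIGHTNESS in abstract form, UNCONDITIONALLY: the crux implies `HodgeEffectiveAbstract`**
(`hodgeEffective_of_transcendentalOrSupported`, whose Deligne-8.2.8 hypothesis is the tree's theorem
`Deligne1974_ker_restrictCompl_eq_iSup_range_complexGysin_holds`, followed by the landed converse bridge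
`hodgeEffectiveAbstract_of_hodgeEffective`): GHC(2p,1) for the middle cohomology implies Voisin's
Conj. 4.7(2p,1) for the phantom constituents, on the tree's carriers.
[cite: Voisin2025, §4.2 (sentence before Conj. 4.7)] [cite: DeligneHodgeIII1974, Cor. 8.2.8] -/
theorem hodgeEffectiveAbstract_of_transcendentalOrSupported
    (hT : Summit.HodgeConjecture.HodgeConjecture.Theses.LinearSystemTorelli.TranscendentalOrSupported) :
    ∀ ⦃p : ℕ⦄ ⦃X : SchemeOver ℂ⦄, 1 ≤ p → ∀ (hX : IsSmoothProjective (2 * p) X)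
      (A : HodgeModel (2 * p) X) (r : ℕ) (b : Fin r → complexBetti X (2 * p)),
      (∀ j, IsRationalClass (b j)) →
      (Submodule.span ℂ (Set.range b)).map (A.pullback (2 * p)).hom =
        ⨆ (p' : ℕ) (q' : ℕ) (_ : p' + q' = 2 * p),
          (Submodule.span ℂ (Set.range b)).map (A.pullback (2 * p)).hom ⊓ A.hodgePQ (2 * p) p' q' →
      (Submodule.span ℂ (Set.range b)).map (A.pullback (2 * p)).hom ⊓ A.hodgePQ (2 * p) (2 * p) 0 = ⊥ →
      (∀ V : Submodule ℂ (complexBetti X (2 * p)), V ≤ Submodule.span ℂ (Set.range b) →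
        Submodule.span ℂ {x : complexBetti X (2 * p) | x ∈ V ∧ IsRationalClass x} = V →
        V.map (A.pullback (2 * p)).hom =
          ⨆ (p' : ℕ) (q' : ℕ) (_ : p' + q' = 2 * p),
            V.map (A.pullback (2 * p)).hom ⊓ A.hodgePQ (2 * p) p' q' →
        V = ⊥ ∨ V = Submodule.span ℂ (Set.range b)) →
      2 ≤ Module.finrank ℂ (Submodule.span ℂ (Set.range b)) →
      Submodule.span ℂ (Set.range b) ≤
        ⨆ (m : ℕ) (Y : SchemeOver ℂ) (_ : IsSmoothProjective m Y) (B : HodgeModel m Y)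
          (a : ℕ) (r : ℕ) (_ : a + 2 * r = 2 * p) (_ : 1 ≤ r)
          (φ : complexBetti Y a →ₗ[ℂ] complexBetti X (2 * p))
          (_ : ∀ c, IsRationalClass c → IsRationalClass (φ c))
          (_ : ∀ (p' q' : ℕ), p' + q' = a → ∀ c, B.pullback a c ∈ B.hodgePQ a p' q' →
            A.pullback (2 * p) (φ c) ∈ A.hodgePQ (2 * p) (p' + r) (q' + r)),
          LinearMap.range φ :=
  hodgeEffectiveAbstract_of_hodgeEffective
    (hodgeEffective_of_transcendentalOrSupported
      Deligne1974_ker_restrictCompl_eq_iSup_range_complexGysin_holds hT)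


/-! ### The crux is exactly HC ∧ Hodge effectivity (unconditional equivalences) -/

/-- **The Hodge conjecture implies `MiddleDivisorSupport`** (item 1081): a rational `(p,p)`-class in
`H²ᵖ(X^{2p})` is algebraic, i.e. in `Nᵖ H²ᵖ ⊆ N¹ H²ᵖ` for `p ≥ 1` (`supportedClasses_mono`).
[cite: Thomas2005Nodes, Thm. 1] [cite: GrothendieckTopology1969, §1] -/
theorem middleDivisorSupport_of_hodgeConjecture (hHC : _root_.HodgeConjecture) :
    Summit.HodgeConjecture.HodgeConjecture.Theses.LinearSystemTorelli.MiddleDivisorSupport :=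
  fun p _ hp hX c hc hct ↦ supportedClasses_mono _ (2 * p) hp ((hHC hX).2 p c hc hct)

/-- **Item 1081 `MiddleDivisorSupport` IS the Hodge conjecture** (Thomas 2005 Thm. 1 in the tree's
divisor-support form, unconditional): `hodgeConjecture_of_middleDivisorSupport` (the route's closed
reduction chain, with `PencilReduction` now a theorem) and `middleDivisorSupport_of_hodgeConjecture`.
[cite: Thomas2005Nodes, Thm. 1] -/
theorem middleDivisorSupport_iff_hodgeConjecture :
    Summit.HodgeConjecture.HodgeConjecture.Theses.LinearSystemTorelli.MiddleDivisorSupport ↔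
      _root_.HodgeConjecture :=
  ⟨hodgeConjecture_of_middleDivisorSupport, middleDivisorSupport_of_hodgeConjecture⟩

/-- **The crux IS `MiddleDivisorSupport` ∧ `HodgeEffectiveAbstract`, unconditionally**: `→` by the
closed glue 2411 (`linearSystemTorelli_supportedOfTranscendentalOrSupported_proof`) and
`hodgeEffectiveAbstract_of_transcendentalOrSupported`; `←` by the abstract assembly
`stub_transcendentalOrSupported_of_middle_of_hodgeEffectiveAbstract`.
[cite: Voisin2025, Conj. 4.7 and Prop. 4.8] [cite: DeligneHodgeIII1974, Cor. 8.2.8] -/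
theorem transcendentalOrSupported_iff_middle_and_hodgeEffectiveAbstract :
    Summit.HodgeConjecture.HodgeConjecture.Theses.LinearSystemTorelli.TranscendentalOrSupported ↔
      (Summit.HodgeConjecture.HodgeConjecture.Theses.LinearSystemTorelli.MiddleDivisorSupport ∧
    ∀ ⦃p : ℕ⦄ ⦃X : SchemeOver ℂ⦄, 1 ≤ p → ∀ (hX : IsSmoothProjective (2 * p) X)
      (A : HodgeModel (2 * p) X) (r : ℕ) (b : Fin r → complexBetti X (2 * p)),
      (∀ j, IsRationalClass (b j)) →
      (Submodule.span ℂ (Set.range b)).map (A.pullback (2 * p)).hom =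
        ⨆ (p' : ℕ) (q' : ℕ) (_ : p' + q' = 2 * p),
          (Submodule.span ℂ (Set.range b)).map (A.pullback (2 * p)).hom ⊓ A.hodgePQ (2 * p) p' q' →
      (Submodule.span ℂ (Set.range b)).map (A.pullback (2 * p)).hom ⊓ A.hodgePQ (2 * p) (2 * p) 0 = ⊥ →
      (∀ V : Submodule ℂ (complexBetti X (2 * p)), V ≤ Submodule.span ℂ (Set.range b) →
        Submodule.span ℂ {x : complexBetti X (2 * p) | x ∈ V ∧ IsRationalClass x} = V →
        V.map (A.pullback (2 * p)).hom =
          ⨆ (p' : ℕ) (q' : ℕ) (_ : p' + q' = 2 * p),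
            V.map (A.pullback (2 * p)).hom ⊓ A.hodgePQ (2 * p) p' q' →
        V = ⊥ ∨ V = Submodule.span ℂ (Set.range b)) →
      2 ≤ Module.finrank ℂ (Submodule.span ℂ (Set.range b)) →
      Submodule.span ℂ (Set.range b) ≤
        ⨆ (m : ℕ) (Y : SchemeOver ℂ) (_ : IsSmoothProjective m Y) (B : HodgeModel m Y)
          (a : ℕ) (r : ℕ) (_ : a + 2 * r = 2 * p) (_ : 1 ≤ r)
          (φ : complexBetti Y a →ₗ[ℂ] complexBetti X (2 * p))
          (_ : ∀ c, IsRationalClass c → IsRationalClass (φ c))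
          (_ : ∀ (p' q' : ℕ), p' + q' = a → ∀ c, B.pullback a c ∈ B.hodgePQ a p' q' →
            A.pullback (2 * p) (φ c) ∈ A.hodgePQ (2 * p) (p' + r) (q' + r)),
          LinearMap.range φ) :=
  ⟨fun hT ↦ ⟨linearSystemTorelli_supportedOfTranscendentalOrSupported_proof hT,
      hodgeEffectiveAbstract_of_transcendentalOrSupported hT⟩,
    fun h ↦ stub_transcendentalOrSupported_of_middle_of_hodgeEffectiveAbstract h.1 h.2⟩

/-- **GHC(2p, coniveau 1) for the middle cohomology IS the Hodge conjecture plus Voisin's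
effectivity Conjecture 4.7(2p, 1) for the phantom constituents — unconditionally, on the tree's
carriers** (`transcendentalOrSupported_iff_middle_and_hodgeEffectiveAbstract` with
`middleDivisorSupport_iff_hodgeConjecture`): the exact content of "The Hodge conjecture itself does
not imply the generalized Hodge conjecture" (Voisin 2025, §4.2) for this crux.
[cite: Voisin2025, §4.2, Conj. 4.7 and Prop. 4.8] [cite: Thomas2005Nodes, Thm. 1] -/
theorem transcendentalOrSupported_iff_hodgeConjecture_and_hodgeEffectiveAbstract :
    Summit.HodgeConjecture.HodgeConjecture.Theses.LinearSystemTorelli.TranscendentalOrSupported ↔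
      (_root_.HodgeConjecture ∧
    ∀ ⦃p : ℕ⦄ ⦃X : SchemeOver ℂ⦄, 1 ≤ p → ∀ (hX : IsSmoothProjective (2 * p) X)
      (A : HodgeModel (2 * p) X) (r : ℕ) (b : Fin r → complexBetti X (2 * p)),
      (∀ j, IsRationalClass (b j)) →
      (Submodule.span ℂ (Set.range b)).map (A.pullback (2 * p)).hom =
        ⨆ (p' : ℕ) (q' : ℕ) (_ : p' + q' = 2 * p),
          (Submodule.span ℂ (Set.range b)).map (A.pullback (2 * p)).hom ⊓ A.hodgePQ (2 * p) p' q' →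
      (Submodule.span ℂ (Set.range b)).map (A.pullback (2 * p)).hom ⊓ A.hodgePQ (2 * p) (2 * p) 0 = ⊥ →
      (∀ V : Submodule ℂ (complexBetti X (2 * p)), V ≤ Submodule.span ℂ (Set.range b) →
        Submodule.span ℂ {x : complexBetti X (2 * p) | x ∈ V ∧ IsRationalClass x} = V →
        V.map (A.pullback (2 * p)).hom =
          ⨆ (p' : ℕ) (q' : ℕ) (_ : p' + q' = 2 * p),
            V.map (A.pullback (2 * p)).hom ⊓ A.hodgePQ (2 * p) p' q' →
        V = ⊥ ∨ V = Submodule.span ℂ (Set.range b)) →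
      2 ≤ Module.finrank ℂ (Submodule.span ℂ (Set.range b)) →
      Submodule.span ℂ (Set.range b) ≤
        ⨆ (m : ℕ) (Y : SchemeOver ℂ) (_ : IsSmoothProjective m Y) (B : HodgeModel m Y)
          (a : ℕ) (r : ℕ) (_ : a + 2 * r = 2 * p) (_ : 1 ≤ r)
          (φ : complexBetti Y a →ₗ[ℂ] complexBetti X (2 * p))
          (_ : ∀ c, IsRationalClass c → IsRationalClass (φ c))
          (_ : ∀ (p' q' : ℕ), p' + q' = a → ∀ c, B.pullback a c ∈ B.hodgePQ a p' q' →
            A.pullback (2 * p) (φ c) ∈ A.hodgePQ (2 * p) (p' + r) (q' + r)),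
          LinearMap.range φ) := by
  rw [transcendentalOrSupported_iff_middle_and_hodgeEffectiveAbstract,
    middleDivisorSupport_iff_hodgeConjecture]

end Summit.HodgeConjecture.HodgeConjecture.Theorems

end
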